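import Literature.NumberTheory.LFunctions.HybridJointUniversalityProofs
import Literature.Analysis.Complex.Mergelyan
import HarnessLib

/-!
# Hybrid joint universality: Theorem 1.1 from Lemma 3.1 alone (Mergelyan discharged)

`Literature.NumberTheory.LFunctions.Pankowski2010_thm1_1_of_lem3_1_of_mergelyan`
(`HybridJointUniversalityReduction.lean`) reduces Pańkowski's Theorem 1.1 (general compact `K` with
connected complement; quoted in `HybridJointUniversality.lean`, whose retired named fact
`Pankowski2010_thm1_1` it was until the D-0026 split review of 2026-08-15 — the statement is now
written out as the conclusion) to two written-out hypotheses: `h31` = his Lemma 3.1 (with Remark 2.1) for Dirichlet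
`L`-functions on open rectangles inside the strip, and `hMer` = Mergelyan's theorem (his Lemma 4.1).
Mergelyan's theorem is now PROVED in the tree (`Literature.Analysis.Complex.mergelyan`,
`Literature/Analysis/Complex/Mergelyan.lean`, Rudin, *Real and Complex Analysis*, Thm. 20.5), so
the reduction needs `h31` only:

* `Pankowski2010_thm1_1_of_lem3_1` — Theorem 1.1 from Lemma 3.1 on rectangles.
* `pankowski_thm1_1_of_subset_closedBall` — **Theorem 1.1 PROVED for every compact `K` with
  connected complement contained in a closed disc inside the strip**, with the printed hypotheses
  on the targets (continuous and non-vanishing on `K`, holomorphic in the interior): Mergelyan's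
  theorem and the zero-free polynomial approximation
  (`Literature.Analysis.Complex.exists_polynomial_norm_sub_exp_lt_of_forall_polynomial`) turn
  the targets into entire zero-free `exp ∘ Qᵢ`, to which the proved disc-analytic theorem
  `Pankowski2010_thm1_1_discAnalytic_holds` applies (this is exactly the source's §4 reduction
  "by the Mergelyan theorem, we can assume that … `fⱼ` are analytic and non-vanishing on some
  simply connected set `G₁`", p. 68, run on a disc);
* `pankowski_thm1_1_closedBall` — the case `K` a closed disc with the printed hypotheses on the
  targets (continuous on the closed disc, holomorphic inside), unconditionally.
* `steuding_thm1_9_of_subset_closedBall` — the same for `ζ` (Steuding, Thm. 1.9 restricted to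
  compacta inside a disc of the strip, continuous targets), from
  `Steuding2007_thm1_9_discAnalytic_holds`.

What remains for Theorem 1.1 in full generality is exactly `h31`: the joint-universality machinery
(denseness of joint finite Euler products in a Bergman space, mean-square approximation along the
Kronecker–Weyl flow, `L²`-to-sup) on RECTANGLES; the tree has it on discs only
(`HybridJointUniversalityProofs.lean`: `Pankowski2010_thm1_1_discAnalytic_holds`), and a tall
compact `K` inside `1/2 < σ < 1` is not contained in any disc inside the strip.

## References

* [Pankowski2010] Ł. Pańkowski, *Hybrid joint universality theorem for Dirichlet L-functions*,
  Acta Arith. 141 (2010), 59–72: Lemma 3.1, Lemma 4.1 (Mergelyan), Thm. 4.2, Thm. 1.1.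
* [Rudin1987] W. Rudin, *Real and Complex Analysis*, 3rd ed. (1987), Thm. 20.5.
* [Steuding2007] J. Steuding, *Value-Distribution of L-Functions*, LNM 1877 (2007), Thm. 1.9,
  Thm. 5.14.
-/

noncomputable section

open Complex Set Metric MeasureTheory

namespace Literature.NumberTheory.LFunctions

/-- **Pańkowski's Theorem 1.1 from his Lemma 3.1** (Mergelyan's theorem, Lemma 4.1 of the source,
being proved in the tree): hypothesis `h31` = Lemma 3.1 with Remark 2.1 for the Dirichlet
`L`-functions of pairwise non-equivalent characters on open rectangles `(a, b) × (c, d)`,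
`1/2 < a < b < 1`, written out as in `Pankowski2010_thm1_1_of_lem3_1_of_mergelyan`; conclusion =
Theorem 1.1 of the source written out (the rendering of `HybridJointUniversality.lean`).
[cite: Pankowski2010, Thm. 1.1, Lemma 3.1, Lemma 4.1 and proof of Thm. 4.2]
[cite: Rudin1987, Thm. 20.5] -/
theorem Pankowski2010_thm1_1_of_lem3_1
    (h31 : ∀ (ι : Type) [Fintype ι] [Nonempty ι] (q : ι → ℕ) [∀ i, NeZero (q i)]
      (χ : ∀ i, DirichletCharacter ℂ (q i)),
      (Pairwise fun i j ↦
        (⟨(χ i).conductor, (χ i).primitiveCharacter⟩ : Σ n, DirichletCharacter ℂ n) ≠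
          ⟨(χ j).conductor, (χ j).primitiveCharacter⟩) →
      ∀ a b c d : ℝ, 1 / 2 < a → a < b → b < 1 → c < d →
      ∀ f : ι → ℂ → ℂ, (∀ i, DifferentiableOn ℂ (f i) (Ioo a b ×ℂ Ioo c d)) →
        (∀ i, ∀ s ∈ (Ioo a b ×ℂ Ioo c d), f i s ≠ 0) →
      ∀ (κ : Type) [Fintype κ] [Nonempty κ] (α : κ → ℝ), LinearIndependent ℚ α → ∀ θ : κ → ℝ,
      ∃ B : Finset ℕ, (∀ p ∈ B, p.Prime) ∧
        ∀ ε : ℝ, 0 < ε → ∀ K₀ : Set ℂ, IsCompact K₀ → K₀ ⊆ (Ioo a b ×ℂ Ioo c d) →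
          ∃ θB : ℕ → ℝ, ∃ δ : ℝ, 0 < δ ∧ ∃ T₀ : ℝ, ∀ T : ℝ, T₀ ≤ T →
            ENNReal.ofReal (δ * T) ≤
              volume ({τ : ℝ | 0 < τ ∧
                (∀ i, ∀ s ∈ K₀, ‖(χ i).LFunction (s + τ * I) *
                      (∏ p ∈ B, (1 - χ i p * (p : ℂ) ^ (-(s + τ * I)))) -
                    f i s * ∏ p ∈ B, (1 - χ i p * Complex.exp (-(2 * Real.pi * I * θB p)) *
                      (p : ℂ) ^ (-s))‖ < ε) ∧
                (∀ p ∈ B, ∃ m : ℤ, |τ * (Real.log p / (2 * Real.pi)) - θB p - m| < ε) ∧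
                ∀ k, ∃ m : ℤ, |τ * α k - θ k - m| < ε} ∩ Icc 0 T)) :
    ∀ (ι : Type) [Fintype ι] [Nonempty ι] (q : ι → ℕ) [∀ i, NeZero (q i)]
      (χ : ∀ i, DirichletCharacter ℂ (q i)),
      (Pairwise fun i j ↦
        (⟨(χ i).conductor, (χ i).primitiveCharacter⟩ : Σ n, DirichletCharacter ℂ n) ≠
          ⟨(χ j).conductor, (χ j).primitiveCharacter⟩) →
      ∀ K : Set ℂ, IsCompact K → IsConnected Kᶜ → K ⊆ {s : ℂ | 1 / 2 < s.re ∧ s.re < 1} →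
      ∀ f : ι → ℂ → ℂ, (∀ i, ContinuousOn (f i) K) → (∀ i, ∀ s ∈ K, f i s ≠ 0) →
        (∀ i, DifferentiableOn ℂ (f i) (interior K)) →
      ∀ (κ : Type) [Fintype κ] [Nonempty κ] (α : κ → ℝ), LinearIndependent ℚ α → ∀ θ : κ → ℝ,
      ∀ ε : ℝ, 0 < ε →
        ∃ δ : ℝ, 0 < δ ∧ ∃ T₀ : ℝ, ∀ T : ℝ, T₀ ≤ T →
          ENNReal.ofReal (δ * T) ≤
            volume ({τ : ℝ | (∀ i, ∀ s ∈ K, ‖(χ i).LFunction (s + τ * I) - f i s‖ < ε) ∧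
              ∀ k, ∃ m : ℤ, |τ * α k - θ k - m| < ε} ∩ Icc 0 T) :=
  Pankowski2010_thm1_1_of_lem3_1_of_mergelyan h31 fun _ hK hKc _ hf hfd _ hε ↦
    Literature.Analysis.Complex.mergelyan hK hKc hf hfd hε

/-- **Pańkowski's Theorem 1.1 for compacta inside a disc of the strip** (PROVED): for pairwise
non-equivalent characters `χ i`, a compact `K` with connected complement contained in a closed
disc `|s − c| ≤ ρ` with `1/2 < Re c − ρ`, `Re c + ρ < 1`, targets `f i` continuous and
non-vanishing on `K` and holomorphic in the interior of `K`, `ℚ`-linearly independent reals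
`α k`, phases `θ k` and `ε > 0`, the set of `τ` with `|L(s + iτ, χ i) − f i(s)| < ε` on `K`
(all `i`) and `‖τ α k − θ k‖ < ε` (all `k`) has positive lower density. Proof: §4 of the source on
a disc — Mergelyan's theorem (`Literature.Analysis.Complex.mergelyan`) and
`Literature.Analysis.Complex.exists_polynomial_norm_sub_exp_lt_of_forall_polynomial` give entire
zero-free `exp ∘ Qᵢ` within `ε/2` of `fᵢ` on `K`; `Pankowski2010_thm1_1_discAnalytic_holds` for
the targets `exp ∘ Qᵢ` on `closedBall c ρ ⊇ K` with `ε/2`; the resulting set of shifts is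
contained in the wanted one. [cite: Pankowski2010, Thm. 1.1 and proof of Thm. 4.2 (p. 68)] -/
theorem pankowski_thm1_1_of_subset_closedBall {ι : Type} [Fintype ι] [Nonempty ι] {q : ι → ℕ}
    [∀ i, NeZero (q i)] (χ : ∀ i, DirichletCharacter ℂ (q i))
    (hχ : Pairwise fun i j ↦
      (⟨(χ i).conductor, (χ i).primitiveCharacter⟩ : Σ n, DirichletCharacter ℂ n) ≠
        ⟨(χ j).conductor, (χ j).primitiveCharacter⟩)
    {K : Set ℂ} (hK : IsCompact K) (hKc : IsPreconnected Kᶜ) {c : ℂ} {ρ : ℝ} (hρ : 0 < ρ)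
    (h₁ : 1 / 2 < c.re - ρ) (h₂ : c.re + ρ < 1) (hKρ : K ⊆ closedBall c ρ) {f : ι → ℂ → ℂ}
    (hfc : ∀ i, ContinuousOn (f i) K) (hf0 : ∀ i, ∀ s ∈ K, f i s ≠ 0)
    (hfd : ∀ i, DifferentiableOn ℂ (f i) (interior K)) {κ : Type} [Fintype κ] [Nonempty κ]
    {α : κ → ℝ} (hα : LinearIndependent ℚ α) (θ : κ → ℝ) {ε : ℝ} (hε : 0 < ε) :
    ∃ δ : ℝ, 0 < δ ∧ ∃ T₀ : ℝ, ∀ T : ℝ, T₀ ≤ T →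
      ENNReal.ofReal (δ * T) ≤
        volume ({τ : ℝ | (∀ i, ∀ s ∈ K, ‖(χ i).LFunction (s + τ * I) - f i s‖ < ε) ∧
          ∀ k, ∃ m : ℤ, |τ * α k - θ k - m| < ε} ∩ Icc 0 T) := by
  -- zero-free entire approximants of the targets (Mergelyan + a holomorphic logarithm)
  have happ : ∀ i, ∃ Q : Polynomial ℂ, ∀ s ∈ K, ‖f i s - Complex.exp (Q.eval s)‖ < ε / 2 :=
    fun i ↦ Literature.Analysis.Complex.exists_polynomial_norm_sub_exp_lt_of_forall_polynomial hK
      hKc (hfc i) (hf0 i)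
      (fun η hη ↦ Literature.Analysis.Complex.mergelyan hK hKc (hfc i) (hfd i) hη) (half_pos hε)
  choose Q hQ using happ
  set g : ι → ℂ → ℂ := fun i s ↦ Complex.exp ((Q i).eval s) with hg
  have hgd : ∀ i, DifferentiableOn ℂ (g i) (ball c (ρ + 1)) := fun i ↦
    ((Q i).differentiable.cexp).differentiableOn
  have hg0 : ∀ i, ∀ s ∈ closedBall c ρ, g i s ≠ 0 := fun i s _ ↦ Complex.exp_ne_zero _
  obtain ⟨δ, hδ, T₀, hT⟩ := Pankowski2010_thm1_1_discAnalytic_holds ι q χ hχ c ρ (ρ + 1) hρ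
    (by linarith) h₁ h₂ g hgd hg0 κ α hα θ (ε / 2) (half_pos hε)
  refine ⟨δ, hδ, T₀, fun T hT' ↦ (hT T hT').trans (measure_mono ?_)⟩
  rintro τ ⟨⟨hL, hk⟩, hτ⟩
  refine ⟨⟨fun i s hs ↦ ?_, fun k ↦ ?_⟩, hτ⟩
  · calc ‖(χ i).LFunction (s + τ * I) - f i s‖
        = ‖((χ i).LFunction (s + τ * I) - g i s) + (g i s - f i s)‖ := by congr 1; ring
      _ ≤ ‖(χ i).LFunction (s + τ * I) - g i s‖ + ‖g i s - f i s‖ := norm_add_le _ _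
      _ < ε / 2 + ε / 2 := by
          refine add_lt_add (hL i s (hKρ hs)) ?_
          rw [norm_sub_rev]
          exact hQ i s hs
      _ = ε := by ring
  · obtain ⟨m, hm⟩ := hk k
    exact ⟨m, hm.trans (half_lt_self hε)⟩

/-- **Pańkowski's Theorem 1.1 on a closed disc, with the printed hypotheses on the targets**
(PROVED): targets continuous and non-vanishing on `|s − c| ≤ ρ` and holomorphic on
`|s − c| < ρ`.
[cite: Pankowski2010, Thm. 1.1 (case K a closed disc)] -/
theorem pankowski_thm1_1_closedBall {ι : Type} [Fintype ι] [Nonempty ι] {q : ι → ℕ}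
    [∀ i, NeZero (q i)] (χ : ∀ i, DirichletCharacter ℂ (q i))
    (hχ : Pairwise fun i j ↦
      (⟨(χ i).conductor, (χ i).primitiveCharacter⟩ : Σ n, DirichletCharacter ℂ n) ≠
        ⟨(χ j).conductor, (χ j).primitiveCharacter⟩)
    {c : ℂ} {ρ : ℝ} (hρ : 0 < ρ) (h₁ : 1 / 2 < c.re - ρ) (h₂ : c.re + ρ < 1) {f : ι → ℂ → ℂ}
    (hfc : ∀ i, ContinuousOn (f i) (closedBall c ρ)) (hf0 : ∀ i, ∀ s ∈ closedBall c ρ, f i s ≠ 0)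
    (hfd : ∀ i, DifferentiableOn ℂ (f i) (ball c ρ)) {κ : Type} [Fintype κ] [Nonempty κ]
    {α : κ → ℝ} (hα : LinearIndependent ℚ α) (θ : κ → ℝ) {ε : ℝ} (hε : 0 < ε) :
    ∃ δ : ℝ, 0 < δ ∧ ∃ T₀ : ℝ, ∀ T : ℝ, T₀ ≤ T →
      ENNReal.ofReal (δ * T) ≤
        volume ({τ : ℝ |
          (∀ i, ∀ s ∈ closedBall c ρ, ‖(χ i).LFunction (s + τ * I) - f i s‖ < ε) ∧
          ∀ k, ∃ m : ℤ, |τ * α k - θ k - m| < ε} ∩ Icc 0 T) :=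
  pankowski_thm1_1_of_subset_closedBall χ hχ (isCompact_closedBall c ρ)
    (isConnected_compl_closedBall c hρ.le).isPreconnected hρ h₁ h₂ subset_rfl hfc hf0
    (fun i ↦ by rw [interior_closedBall c hρ.ne']; exact hfd i) hα θ hε

/-- **Voronin–Bagchi universality of `ζ` for compacta inside a disc of the strip** (Steuding,
Thm. 1.9, case `K ⊆` a closed disc `|s − c| ≤ ρ` with `1/2 < Re c − ρ`, `Re c + ρ < 1`; PROVED):
for `K` compact with connected complement inside such a disc, `g` continuous and non-vanishing on
`K` and holomorphic in the interior of `K`, and `ε > 0`, the set of `τ ∈ [0, T]` with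
`max_{s∈K} |ζ(s + iτ) − g(s)| < ε` has measure `≥ δT` for some `δ > 0` and all large `T`. Proof:
Mergelyan's theorem and the zero-free approximation give an entire zero-free `exp ∘ Q` within
`ε/2` of `g` on `K`; apply the proved disc theorem `Steuding2007_thm1_9_discAnalytic_holds` to
`exp ∘ Q` on `closedBall c ρ ⊇ K` with `ε/2`. (The general Thm. 1.9 — every compact `K` with
connected complement in `1/2 < σ < 1` — still needs the universality machinery on general
domains; see the module docstring.) [cite: Steuding2007, Thm. 1.9 and Thm. 5.14 (proof)] -/
theorem steuding_thm1_9_of_subset_closedBall {K : Set ℂ} (hK : IsCompact K)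
    (hKc : IsPreconnected Kᶜ) {c : ℂ} {ρ : ℝ} (hρ : 0 < ρ) (h₁ : 1 / 2 < c.re - ρ)
    (h₂ : c.re + ρ < 1) (hKρ : K ⊆ closedBall c ρ) {g : ℂ → ℂ} (hgc : ContinuousOn g K)
    (hg0 : ∀ s ∈ K, g s ≠ 0) (hgd : DifferentiableOn ℂ g (interior K)) {ε : ℝ} (hε : 0 < ε) :
    ∃ δ : ℝ, 0 < δ ∧ ∃ T₀ : ℝ, ∀ T : ℝ, T₀ ≤ T →
      ENNReal.ofReal (δ * T) ≤
        volume ({τ : ℝ | ∀ s ∈ K, ‖riemannZeta (s + τ * I) - g s‖ < ε} ∩ Icc 0 T) := by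
  obtain ⟨Q, hQ⟩ := Literature.Analysis.Complex.exists_polynomial_norm_sub_exp_lt_of_forall_polynomial
    hK hKc hgc hg0 (fun η hη ↦ Literature.Analysis.Complex.mergelyan hK hKc hgc hgd hη)
    (half_pos hε)
  have hfd : DifferentiableOn ℂ (fun s ↦ Complex.exp (Q.eval s)) (ball c (ρ + 1)) :=
    (Q.differentiable.cexp).differentiableOn
  obtain ⟨δ, hδ, T₀, hT⟩ := Steuding2007_thm1_9_discAnalytic_holds c ρ (ρ + 1) hρ (by linarith)
    h₁ h₂ (fun s ↦ Complex.exp (Q.eval s)) hfd (fun s _ ↦ Complex.exp_ne_zero _) (ε / 2)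
    (half_pos hε)
  refine ⟨δ, hδ, T₀, fun T hT' ↦ (hT T hT').trans (measure_mono ?_)⟩
  rintro τ ⟨hL, hτ⟩
  refine ⟨fun s hs ↦ ?_, hτ⟩
  calc ‖riemannZeta (s + τ * I) - g s‖
      = ‖(riemannZeta (s + τ * I) - Complex.exp (Q.eval s)) + (Complex.exp (Q.eval s) - g s)‖ := by
        congr 1; ring
    _ ≤ ‖riemannZeta (s + τ * I) - Complex.exp (Q.eval s)‖ + ‖Complex.exp (Q.eval s) - g s‖ :=
        norm_add_le _ _
    _ < ε / 2 + ε / 2 := by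
        refine add_lt_add (hL s (hKρ hs)) ?_
        rw [norm_sub_rev]
        exact hQ s hs
    _ = ε := by ring

end Literature.NumberTheory.LFunctions
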